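import Literature.Probability.Percolation.SlabGluingFact2RouteExt
import HarnessLib

/-!
# DST 2016, §2.3, Fact 2 — routing with linked ends and a branch tail

Topic: `Literature/Probability/Percolation`. Towards the verbatim discharge of
`DuminilCopinSidoraviciusTassion2016_fact2` (`SlabGluing.lean`). The remaining local surgeries
(`SlabGluingFact2Boxes.lean`, module docstring) take place in a cleared box whose routing region is a
rectangle `R` together with a ZONE of one or two boundary columns (at the ends of `Z_n`, next to the
end of `γ_min`, next to `S_{3n}`): the ends `E₁, E₂` of the rerouted piece and the branch target
`w'` may lie in the zone. This file reduces ALL such routings to the tree's rectangular routing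
`exists_route` (`SlabGluingRouting.lean`) in one statement:

* `exists_route_linked` — PROVED: given self-avoiding lattice LINK paths `ℓ₁ : E₁ → E₁'`,
  `ℓ₂ : E₂' → E₂` and a branch TAIL `w'' :: T → w'` whose vertices (other than the attachment
  vertices `E₁', E₂', w''` over the rectangle) lie outside the rectangle, pairwise disjoint, with
  `E₁' ≠ E₂'` and `w''` in a column different from those of `E₁', E₂'`, the route of `exists_route`
  between `E₁', E₂', w''` extends to DST's three paths between `E₁, E₂, w'` (`RouteSpec`): the
  rerouted piece is `ℓ₁`, the rectangular piece, `ℓ₂`; the attachment vertex and the branch are those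
  of the rectangular route (so DST's order condition is inherited), the branch being prolonged by
  `T`. The proof is bookkeeping: gluing of self-avoiding paths (`SPath.trans3`), and the successor of
  the attachment vertex is unchanged because the rectangular piece sits contiguously inside the new
  one (`eq_of_cons_cons_eq_append`).

The callers (the zone instances) supply the links (one horizontal step for a cell of the zone
adjacent to `R`, two for the far zone column) and the tail (a run through the zone at a height
avoiding the other structure vertices), which is where the case analysis of those files lives.

## Sources

* H. Duminil-Copin, V. Sidoravicius, V. Tassion, *Absence of infinite cluster for critical
  Bernoulli percolation on slabs*, CPAM 69 (2016), arXiv:1401.7130, §2.3, proof of Fact 2 (the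
  three disjoint self-avoiding paths `γ_u, γ_v, γ_w` in `\overline{B_R}(z) ∖ {z}` and the order condition
  `(z,v) ≺ (z,w)`).
-/

noncomputable section

namespace Literature.Probability.Percolation

open LatticeModels SimpleGraph

variable {k : ℕ}

/-- PROVED — **routing with linked ends and a branch tail** (see the module docstring).
Hypotheses: the rectangle data of `exists_route` for `E₁', E₂', w''`; link paths `ℓ₁ : E₁ → E₁'`,
`ℓ₂ : E₂' → E₂` and a tail `w'' :: T → w'`, all outside the big rectangle except at `E₁', E₂', w''`,
`ℓ₁` disjoint from `ℓ₂` and both from `T`; target regions `RP ⊇ R ∪ ℓ₁ ∪ ℓ₂`, `D ⊇ D_R ∪ T`.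
Conclusion: a `RouteSpec` for `E₁, E₂, w'` whose rerouted piece consists of `ℓ₁`, `ℓ₂` and vertices
over `R`, and whose branch consists of `T` and vertices over `D_R`.
[cite: DuminilCopinSidoraviciusTassion2016, §2.3, proof of Fact 2 (the three disjoint paths)] -/
theorem exists_route_linked (hk : 1 ≤ k) {xL xR' xR rB rP rT : ℤ} (hcols : xL + 2 ≤ xR')
    (hxR : xR' ≤ xR) (hrows : rB + 3 ≤ rP) (hrP : rP ≤ rT)
    {E₁ E₁' E₂ E₂' w' w'' : slab 3 k} {ℓ₁ ℓ₂ T : List (slab 3 k)}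
    (ha : planar k E₁' ∈ boxR xL xR' rB rP) (hb : planar k E₂' ∈ boxR xL xR' rB rP)
    (hd : planar k w'' ∈ boxR xL xR rB rT) (hE : E₁' ≠ E₂')
    (had : planar k E₁' ≠ planar k w'') (hbd : planar k E₂' ≠ planar k w'')
    (hℓ₁ : SPath ℓ₁ E₁ E₁') (hℓ₂ : SPath ℓ₂ E₂' E₂) (hT : SPath (w'' :: T) w'' w')
    (hℓ₁out : ∀ v ∈ ℓ₁, v ≠ E₁' → planar k v ∉ boxR xL xR rB rT)
    (hℓ₂out : ∀ v ∈ ℓ₂, v ≠ E₂' → planar k v ∉ boxR xL xR rB rT)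
    (hTout : ∀ v ∈ T, planar k v ∉ boxR xL xR rB rT)
    (h12 : ∀ v ∈ ℓ₁, v ∉ ℓ₂) (h1T : ∀ v ∈ ℓ₁, v ∉ T) (h2T : ∀ v ∈ ℓ₂, v ∉ T)
    {RP D : Set (ℤ × ℤ)} (hRP : boxR xL xR' rB rP ⊆ RP) (hD : boxR xL xR rB rT ⊆ D)
    (hℓ₁RP : ∀ v ∈ ℓ₁, planar k v ∈ RP) (hℓ₂RP : ∀ v ∈ ℓ₂, planar k v ∈ RP)
    (hTD : ∀ v ∈ T, planar k v ∈ D) :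
    ∃ (L Br : List (slab 3 k)) (c : slab 3 k), RouteSpec k RP D E₁ E₂ w' L Br c ∧
      (∀ v ∈ L, v ∈ ℓ₁ ∨ v ∈ ℓ₂ ∨ planar k v ∈ boxR xL xR' rB rP) ∧
      (∀ v ∈ Br, v ∈ T ∨ planar k v ∈ boxR xL xR rB rT) ∧ planar k c ∈ boxR xL xR' rB rP := by
  obtain ⟨Ls, Brs, c, spec⟩ := exists_route hk hcols hxR hrows hrP ha hb hd hE had hbd
  have hRD : boxR xL xR' rB rP ⊆ boxR xL xR rB rT := fun q hq => by
    rw [mem_boxR_iff] at hq ⊢; omega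
  have hLsD : ∀ v ∈ Ls, planar k v ∈ boxR xL xR rB rT := fun v hv => hRD (spec.hL_sub v hv)
  have hE₁'Ls : E₁' ∈ Ls := spec.hL.head_mem
  have hE₂'Ls : E₂' ∈ Ls := spec.hL.last_mem
  -- gluing the rerouted piece
  obtain ⟨hL, hLmem⟩ := SPath.trans3 hℓ₁ spec.hL hℓ₂
    (fun v hv hvL => by
      by_contra hne
      exact hℓ₁out v hv hne (hLsD v hvL))
    (fun v hv hv₂ => by
      by_contra hne
      have hout := hℓ₂out v hv₂ hne
      rcases hv with hv | hv
      · by_cases hv1 : v = E₁'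
        · exact hout (hv1 ▸ hLsD _ hE₁'Ls)
        · exact h12 v hv hv₂
      · exact hout (hLsD v hv))
  -- gluing the branch and the tail
  obtain ⟨hCB, hCBmem⟩ := spec.hCB.trans hT fun v hv hvT => by
    rcases List.mem_cons.1 hvT with h | h
    · exact h
    · exfalso
      refine hTout v h ?_
      rcases List.mem_cons.1 hv with rfl | hv
      · exact hLsD _ spec.hc
      · exact spec.hBr_sub v hv
  refine ⟨ℓ₁ ++ Ls.tail ++ ℓ₂.tail, Brs ++ T, c, ⟨hL, ?_, ?_, ?_, by simp [spec.hBr], by simpa using hCB,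
    ?_, ?_, ?_⟩, ?_, ?_, spec.hL_sub c spec.hc⟩
  · -- the rerouted piece lies over `RP`
    intro v hv
    rcases (hLmem v).1 hv with h | h | h
    · exact hℓ₁RP v h
    · exact hRP (spec.hL_sub v h)
    · exact hℓ₂RP v h
  · exact (hLmem c).2 (Or.inr (Or.inl spec.hc))
  · -- `c ≠ E₂`
    intro hcE
    by_cases h2 : E₂ = E₂'
    · exact spec.hcE₂ (hcE.trans h2)
    · exact hℓ₂out E₂ hℓ₂.last_mem h2 (hcE ▸ hLsD c spec.hc)
  · -- the branch lies over `D`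
    intro v hv
    rcases List.mem_append.1 hv with h | h
    · exact hD (spec.hBr_sub v h)
    · exact hTD v h
  · -- the branch is off the rerouted piece
    intro v hv hvL
    rcases List.mem_append.1 hv with h | h
    · have hvD := spec.hBr_sub v h
      rcases (hLmem v).1 hvL with h' | h' | h'
      · by_cases hv1 : v = E₁'
        · exact spec.hBr_L v h (hv1 ▸ hE₁'Ls)
        · exact hℓ₁out v h' hv1 hvD
      · exact spec.hBr_L v h h'
      · by_cases hv2 : v = E₂'
        · exact spec.hBr_L v h (hv2 ▸ hE₂'Ls)
        · exact hℓ₂out v h' hv2 hvD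
    · have hvD := hTout v h
      rcases (hLmem v).1 hvL with h' | h' | h'
      · exact h1T v h' h
      · exact hvD (hLsD v h')
      · exact h2T v h' h
  · -- DST's order condition: the successor of `c` is that of the rectangular route
    intro l₁ l₂ y heq b hb
    have hb' : b ∈ Brs.head? := by
      obtain ⟨b₀, r, hBrs⟩ := List.exists_cons_of_ne_nil spec.hBr
      rw [hBrs] at hb ⊢
      simpa using hb
    obtain ⟨p, s, hLs_eq⟩ := List.append_of_mem spec.hc
    have hs : s ≠ [] := by
      rintro rfl
      have := spec.hL.last
      rw [hLs_eq, List.getLast?_concat] at this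
      exact spec.hcE₂ (Option.some.inj this)
    obtain ⟨y₀, s', rfl⟩ := List.exists_cons_of_ne_nil hs
    have key := spec.hfwd p s' y₀ hLs_eq b hb'
    -- the new piece is `ℓ₁.dropLast ++ Ls ++ ℓ₂.tail`
    have hℓ₁eq : ℓ₁ = ℓ₁.dropLast ++ [E₁'] := (List.dropLast_append_getLast? E₁' (by rw [hℓ₁.last]; rfl)).symm
    have hLseq : Ls = E₁' :: Ls.tail := by
      obtain ⟨a, t, hat⟩ := List.exists_cons_of_ne_nil spec.hL.ne_nil
      have := spec.hL.head
      rw [hat] at this ⊢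
      simp only [List.head?_cons, Option.some.injEq] at this
      simp [this]
    have hnew : ℓ₁ ++ Ls.tail ++ ℓ₂.tail = (ℓ₁.dropLast ++ p) ++ c :: y₀ :: (s' ++ ℓ₂.tail) := by
      have h1 : ℓ₁ ++ Ls.tail = ℓ₁.dropLast ++ Ls := by
        conv_lhs => rw [hℓ₁eq]
        conv_rhs => rw [hLseq]
        simp
      rw [h1, hLs_eq]; simp
    have := eq_of_cons_cons_eq_append hL.nodup hnew heq
    rw [this]; exact key
  · -- where the rerouted piece lives
    intro v hv
    rcases (hLmem v).1 hv with h | h | h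
    · exact Or.inl h
    · exact Or.inr (Or.inr (spec.hL_sub v h))
    · exact Or.inr (Or.inl h)
  · -- where the branch lives
    intro v hv
    rcases List.mem_append.1 hv with h | h
    · exact Or.inr (spec.hBr_sub v h)
    · exact Or.inl h

end Literature.Probability.Percolation

end
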